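import Mathlib.Topology.Algebra.Star
import Literature.AlgebraicGeometry.Frobenioids.ArchimedeanConjRotation
import HarnessLib

/-!
# Frobenioids II, Example 3.3 / Theorem 3.6 (vii) — `C₀`-level geometry of LINEAR arrows: the induced
# map on angular directions, images of boundaries, a constructor for linear arrows

Mochizuki, *The geometry of Frobenioids II*, Kyushu J. Math. **62** (2008) 401–460, §3: Definition 3.1
(iii) p. 24 (angular regions `A = B × (0, λ]`, boundaries "`∂A` maps bijectively via the projection
`K^× → O_K^×` to `B`"), Example 3.3 (i) p. 27 (arrows `(Base, deg_Fr, V_L^{⊗d} ⥲ V_K|_L)` of `C₀`),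
Theorem 3.6 (vii) p. 37 ("the assignment that maps an isometric pre-step `B → A` to the image of the
boundary `∂A_B` … in the boundary `∂A_A`") [cite: MochizukiFrdII2008, Thm 3.6 (vii) p.37].

For a LINEAR arrow `φ = (b, 1, c) : Y → X` of `C₀` (abc-iut-L1-t6's model, regions read in `ℂ^×`), the
underlying map `z ↦ b(c · z)` acts on angular directions `O_ℂ^× = S¹` by `w ↦ b(u_c · w)` (`u_c` the unit
part of `c`, `b` acting by the identity or inversion): `dirMap`. This file PROVES: the angular condition
"(c) maps `A_L` into `A_K|_L`" for linear data is EQUIVALENT to "directions of `Y` are carried into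
directions of `X`" plus `|c| · tip(Y) ≤ tip(X)` (constructor `C0.linHom`, converse `C0.dirMap_mem_dir`);
for an isometric linear arrow the image of the boundary `∂A_Y` is the part of the circle `|z| = tip(X)`
with directions in `dirIm φ` (`C0.image_boundary`), in particular inside `∂A_X`; boundaries are
connected; the unit-part map `ℂ^× → O_ℂ^×` is continuous; cancellation of linear base-isomorphisms.
Input for the equivalence `F^imtr-pre_A ⥲ Open⁰(∂A_A)` of Thm. 3.6 (vii) (`ArchimedeanBoundaryOpens.lean`,
seat abc-iut-L1-t9). Everything here is PROVED; no statement of the paper is strengthened.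
-/

namespace Literature.AlgebraicGeometry.Frobenioids

open CategoryTheory
open scoped Pointwise

noncomputable section

namespace ArchFrd

/-! ### The Galois action on directions `O_ℂ^×` and the direction map of linear data -/

/-- The action of `σ ∈ Gal(ℂ/ℝ)` on `O_ℂ^× = S¹`: identity or inversion (= complex conjugation).
[cite: MochizukiFrdII2008, Def 3.1 (i) p.23] -/
def unitGal : Bool → ↥(normOneSubgroup ℂ) → ↥(normOneSubgroup ℂ)
  | false, w => w
  | true, w => w⁻¹

/-- `unitGal false = id`. [cite: MochizukiFrdII2008, Def 3.1 (i) p.23] -/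
@[simp] theorem unitGal_false (w : ↥(normOneSubgroup ℂ)) : unitGal false w = w := rfl

/-- `unitGal true = (·)⁻¹`. [cite: MochizukiFrdII2008, Def 3.1 (i) p.23] -/
@[simp] theorem unitGal_true (w : ↥(normOneSubgroup ℂ)) : unitGal true w = w⁻¹ := rfl

/-- `unitGal σ` is the restriction of `galAct σ` to `O_ℂ^×`. [cite: MochizukiFrdII2008, Def 3.1 (i) p.23] -/
theorem coe_unitGal (σ : Bool) (w : ↥(normOneSubgroup ℂ)) :
    ((unitGal σ w : ↥(normOneSubgroup ℂ)) : ℂˣ) = D0.galAct σ (w : ℂˣ) := by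
  cases σ with
  | false => rfl
  | true => rw [unitGal_true, D0.galAct_true, star_coe_normOne]

/-- `unitGal σ` is multiplicative. [cite: MochizukiFrdII2008, Def 3.1 (i) p.23] -/
theorem unitGal_mul (σ : Bool) (a b : ↥(normOneSubgroup ℂ)) : unitGal σ (a * b) = unitGal σ a * unitGal σ b := by
  cases σ with
  | false => rfl
  | true => simp only [unitGal_true, mul_inv]

/-- `unitGal σ` commutes with inversion. [cite: MochizukiFrdII2008, Def 3.1 (i) p.23] -/
theorem unitGal_inv (σ : Bool) (a : ↥(normOneSubgroup ℂ)) : unitGal σ a⁻¹ = (unitGal σ a)⁻¹ := by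
  cases σ <;> rfl

/-- `unitGal σ` is an involution. [cite: MochizukiFrdII2008, Def 3.1 (i) p.23] -/
@[simp] theorem unitGal_unitGal (σ : Bool) (a : ↥(normOneSubgroup ℂ)) : unitGal σ (unitGal σ a) = a := by
  cases σ with
  | false => rfl
  | true => simp only [unitGal_true, inv_inv]

/-- `unitGal` is additive in `σ ∈ ℤ/2ℤ`. [cite: MochizukiFrdII2008, Def 3.1 (i) p.23] -/
theorem unitGal_xor (σ τ : Bool) (a : ↥(normOneSubgroup ℂ)) : unitGal (xor σ τ) a = unitGal τ (unitGal σ a) := by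
  cases σ <;> cases τ <;> simp

/-- `unitGal σ` is continuous. [cite: MochizukiFrdII2008, Def 3.1 (i) p.23] -/
theorem continuous_unitGal (σ : Bool) : Continuous (unitGal σ) := by
  cases σ with
  | false => exact continuous_id
  | true => exact continuous_inv

/-- `unitGal σ` is injective. [cite: MochizukiFrdII2008, Def 3.1 (i) p.23] -/
theorem unitGal_injective (σ : Bool) : Function.Injective (unitGal σ) := fun a b h => by
  rw [← unitGal_unitGal σ a, h, unitGal_unitGal]

/-- `unitGal σ` as a self-homeomorphism of `O_ℂ^×`. [cite: MochizukiFrdII2008, Def 3.1 (i) p.23] -/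
def unitGalHomeo : Bool → (↥(normOneSubgroup ℂ) ≃ₜ ↥(normOneSubgroup ℂ))
  | false => Homeomorph.refl _
  | true => Homeomorph.inv ↥(normOneSubgroup ℂ)

/-- `unitGalHomeo σ` is `unitGal σ`. [cite: MochizukiFrdII2008, Def 3.1 (i) p.23] -/
theorem coe_unitGalHomeo (σ : Bool) : ⇑(unitGalHomeo σ) = unitGal σ := by
  cases σ <;> rfl

/-- The DIRECTION MAP of linear data `(σ, u)`: `w ↦ σ(u · w)` on `O_ℂ^×` — the effect on angular
directions of the underlying map `z ↦ σ(c · z)` of a linear arrow with `unitPart(c) = u`.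
[cite: MochizukiFrdII2008, Ex 3.3 (i) p.27] -/
def dirMap (σ : Bool) (u w : ↥(normOneSubgroup ℂ)) : ↥(normOneSubgroup ℂ) := unitGal σ (u * w)

/-- The direction map as a self-homeomorphism of `O_ℂ^×`. [cite: MochizukiFrdII2008, Ex 3.3 (i) p.27] -/
def dirMapHomeo (σ : Bool) (u : ↥(normOneSubgroup ℂ)) : ↥(normOneSubgroup ℂ) ≃ₜ ↥(normOneSubgroup ℂ) :=
  (Homeomorph.mulLeft u).trans (unitGalHomeo σ)

/-- `dirMapHomeo σ u` is `dirMap σ u`. [cite: MochizukiFrdII2008, Ex 3.3 (i) p.27] -/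
theorem coe_dirMapHomeo (σ : Bool) (u : ↥(normOneSubgroup ℂ)) : ⇑(dirMapHomeo σ u) = dirMap σ u := by
  funext w
  change unitGalHomeo σ (u * w) = unitGal σ (u * w)
  rw [coe_unitGalHomeo]

/-- The direction map is continuous in `w`. [cite: MochizukiFrdII2008, Ex 3.3 (i) p.27] -/
theorem continuous_dirMap (σ : Bool) (u : ↥(normOneSubgroup ℂ)) : Continuous (dirMap σ u) :=
  (continuous_unitGal σ).comp (continuous_const.mul continuous_id)

/-- The direction map is injective in `w`. [cite: MochizukiFrdII2008, Ex 3.3 (i) p.27] -/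
theorem dirMap_injective (σ : Bool) (u : ↥(normOneSubgroup ℂ)) : Function.Injective (dirMap σ u) :=
  fun _ _ h => mul_left_cancel (unitGal_injective σ h)

/-- The unit part of a Galois twist is the twist of the unit part. [cite: MochizukiFrdII2008, Def 3.1 (ii) p.24] -/
theorem unitPart_galAct (σ : Bool) (z : ℂˣ) : unitPart ℂ (D0.galAct σ z) = unitGal σ (unitPart ℂ z) := by
  cases σ with
  | false => rfl
  | true => rw [unitPart_galAct_true]; rfl

/-- The unit part of `σ(c · z)` is `dirMap σ (unitPart c) (unitPart z)`. [cite: MochizukiFrdII2008, Ex 3.3 (i) p.27] -/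
theorem unitPart_galAct_mul_eq_dirMap (σ : Bool) (c z : ℂˣ) :
    unitPart ℂ (D0.galAct σ (c * z)) = dirMap σ (unitPart ℂ c) (unitPart ℂ z) := by
  rw [unitPart_galAct, unitPart_mul]; rfl

/-! ### The unit-part map `ℂ^× → O_ℂ^×` is continuous; the canonical decomposition is injective -/

/-- `u ↦ u/|u|`, `ℂ^× → O_ℂ^×`, is continuous. [cite: MochizukiFrdII2008, Def 3.1 (ii) p.24] -/
theorem continuous_unitPart : Continuous (unitPart ℂ : ℂˣ → ↥(normOneSubgroup ℂ)) := by
  have hn : Continuous fun u : ℂˣ => (((‖(u : ℂ)‖ : ℝ)) : ℂ) :=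
    Complex.continuous_ofReal.comp (continuous_norm.comp Units.continuous_val)
  have h1 : Continuous fun u : ℂˣ => (ofPosReal ℂ (absHom ℂ u) : ℂˣ) := by
    refine Units.continuous_iff.2 ⟨hn, ?_⟩
    change Continuous fun u : ℂˣ => ((((‖(u : ℂ)‖ : ℝ)) : ℂ))⁻¹
    exact hn.inv₀ fun u => Complex.ofReal_ne_zero.mpr (norm_ne_zero_iff.mpr u.ne_zero)
  exact (continuous_id.mul h1.inv).subtype_mk _

/-- An element of `ℂ^×` is determined by its unit part and its absolute value (Def. 3.1 (ii), the
canonical decomposition is a bijection). [cite: MochizukiFrdII2008, Def 3.1 (ii) p.24] -/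
theorem eq_of_unitPart_eq_of_absHom_eq {x y : ℂˣ} (h1 : unitPart ℂ x = unitPart ℂ y)
    (h2 : absHom ℂ x = absHom ℂ y) : x = y := by
  rw [← (unitDecomposition ℂ).apply_symm_apply x, ← (unitDecomposition ℂ).apply_symm_apply y]
  change ((unitPart ℂ x : ℂˣ)) * ofPosReal ℂ (absHom ℂ x) = ((unitPart ℂ y : ℂˣ)) * ofPosReal ℂ (absHom ℂ y)
  rw [h1, h2]

/-! ### Boundaries of angular regions -/

/-- Membership in the boundary: direction in `B` and absolute value `= λ`.
[cite: MochizukiFrdII2008, Def 3.1 (iii) p.24] -/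
theorem AngularRegion.mem_boundary_iff (R : AngularRegion ℂ) (x : ℂˣ) :
    x ∈ R.boundary ↔ unitPart ℂ x ∈ R.dir ∧ absHom ℂ x = R.tip := by
  constructor
  · intro h; exact ⟨h.1.1, h.2⟩
  · intro h; exact ⟨⟨h.1, le_of_eq h.2⟩, h.2⟩

/-- `w · λ ∈ ∂A` for `w ∈ B`. [cite: MochizukiFrdII2008, Def 3.1 (iii) p.24] -/
theorem AngularRegion.coe_mul_ofPosReal_mem_boundary (R : AngularRegion ℂ) {w : ↥(normOneSubgroup ℂ)}
    (hw : w ∈ R.dir) : (w : ℂˣ) * ofPosReal ℂ R.tip ∈ R.boundary := by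
  obtain ⟨h1, h2⟩ := unitPart_absHom_polar w R.tip
  rw [R.mem_boundary_iff, h1, h2]
  exact ⟨hw, rfl⟩

/-- The boundary is the image of the angular part under `w ↦ w · λ`.
[cite: MochizukiFrdII2008, Def 3.1 (iii) p.24] -/
theorem AngularRegion.boundary_eq_image (R : AngularRegion ℂ) :
    R.boundary = (fun w : ↥(normOneSubgroup ℂ) => (w : ℂˣ) * ofPosReal ℂ R.tip) '' R.dir := by
  ext x
  constructor
  · intro hx
    refine ⟨unitPart ℂ x, hx.1.1, ?_⟩
    have h : ((unitPart ℂ x : ℂˣ)) * ofPosReal ℂ (absHom ℂ x) = x := (unitDecomposition ℂ).apply_symm_apply x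
    rw [hx.2] at h
    exact h
  · rintro ⟨w, hw, rfl⟩
    exact R.coe_mul_ofPosReal_mem_boundary hw

/-- The boundary `∂A` of an angular region of `ℂ^×` is connected (its angular part `B` is).
[cite: MochizukiFrdII2008, Def 3.1 (iii) p.24] -/
theorem AngularRegion.isConnected_boundary (R : AngularRegion ℂ) : IsConnected R.boundary := by
  rw [R.boundary_eq_image]
  exact R.isConnected_dir.image _ (continuous_subtype_val.mul continuous_const).continuousOn

/-! ### Linear arrows of `C₀`: directions and a constructor -/

namespace C0

variable {X Y Y' : C0}

/-- For a LINEAR arrow `φ = (b, 1, c) : Y → X`, directions of `Y` are carried into directions of `X`: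
`b(u_c · w) ∈ B_X` for `w ∈ B_Y` (evaluate the angular condition (c) at the boundary point `w · tip(Y)`).
[cite: MochizukiFrdII2008, Ex 3.3 (i) p.27] -/
theorem dirMap_mem_dir (φ : Y ⟶ X) (hd : degFr φ = 1) {w : ↥(normOneSubgroup ℂ)} (hw : w ∈ Y.region.dir) :
    dirMap (D0.Hom.twists (Base φ)) (unitPart ℂ (scalar φ)) w ∈ X.region.dir := by
  have hz : (w : ℂˣ) * ofPosReal ℂ Y.region.tip ∈ Y.region.carrier :=
    Y.region.boundary_subset (Y.region.coe_mul_ofPosReal_mem_boundary hw)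
  have hmem : scalar φ * ((w : ℂˣ) * ofPosReal ℂ Y.region.tip) ∈ pullRegion X (Base φ) := by
    apply Hom.mapsTo φ
    rw [show (degFr φ : ℕ) = 1 from by rw [hd]; rfl, pow_one]
    exact Set.smul_mem_smul_set hz
  obtain ⟨x, hx, hxeq⟩ := hmem
  have hx' : D0.galAct (D0.Hom.twists (Base φ)) (scalar φ * ((w : ℂˣ) * ofPosReal ℂ Y.region.tip)) ∈
      X.region.carrier := by
    rw [← hxeq]
    change D0.galAct _ (D0.galAct _ x) ∈ _
    rw [D0.galAct_galAct]; exact hx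
  have h := hx'.1
  rw [unitPart_galAct_mul_eq_dirMap, (unitPart_absHom_polar w _).1] at h
  exact h

/-- The set of directions of `X` hit by a linear arrow `φ : Y → X`: `dirIm φ = {b(u_c · w) | w ∈ B_Y}`.
[cite: MochizukiFrdII2008, Thm 3.6 (vii) p.37] -/
def dirIm (φ : Y ⟶ X) : Set ↥(normOneSubgroup ℂ) :=
  dirMap (D0.Hom.twists (Base φ)) (unitPart ℂ (scalar φ)) '' Y.region.dir

/-- `dirIm φ ⊆ B_X` for linear `φ`. [cite: MochizukiFrdII2008, Thm 3.6 (vii) p.37] -/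
theorem dirIm_subset_dir (φ : Y ⟶ X) (hd : degFr φ = 1) : dirIm φ ⊆ X.region.dir := by
  rintro _ ⟨w, hw, rfl⟩; exact dirMap_mem_dir φ hd hw

/-- `dirIm φ` is open (a rotated, possibly inverted copy of the open `B_Y`).
[cite: MochizukiFrdII2008, Thm 3.6 (vii) p.37] -/
theorem isOpen_dirIm (φ : Y ⟶ X) : IsOpen (dirIm φ) := by
  rw [dirIm, ← coe_dirMapHomeo]
  exact (dirMapHomeo _ _).isOpen_image.2 Y.region.isOpen_dir

/-- `dirIm φ` is connected. [cite: MochizukiFrdII2008, Thm 3.6 (vii) p.37] -/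
theorem isConnected_dirIm (φ : Y ⟶ X) : IsConnected (dirIm φ) :=
  Y.region.isConnected_dir.image _ (continuous_dirMap _ _).continuousOn

/-- For an ISOMETRIC LINEAR arrow `φ = (b, 1, c) : Y → X` (`|c| · tip(Y) = tip(X)`), the image of the
boundary `∂A_Y` under the underlying map `z ↦ b(c · z)` is the part of the circle `|x| = tip(X)` with
directions in `dirIm φ` (Thm. 3.6 (vii): "the image of the boundary `∂A_B` … in the boundary `∂A_A`").
[cite: MochizukiFrdII2008, Thm 3.6 (vii) p.37] -/
theorem image_boundary (φ : Y ⟶ X) (hd : degFr φ = 1) (hi : PreFrobenioid.IsIsometry C0.toElem φ) :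
    (fun z => D0.galAct (D0.Hom.twists (Base φ)) (scalar φ * z)) '' Y.region.boundary =
      {x | absHom ℂ x = X.region.tip ∧ unitPart ℂ x ∈ dirIm φ} := by
  rw [A0.isIsometry_iff_norm_mul_tip_pow, hd, PNat.one_coe, pow_one] at hi
  -- the isometry condition as an identity of positive reals
  have htip : absHom ℂ (scalar φ) * Y.region.tip = X.region.tip := Subtype.ext hi
  ext x
  constructor
  · rintro ⟨z, hz, rfl⟩
    rw [Y.region.mem_boundary_iff] at hz
    refine ⟨?_, ?_⟩
    · rw [absHom_galAct, map_mul, hz.2, htip]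
    · rw [unitPart_galAct_mul_eq_dirMap]; exact ⟨_, hz.1, rfl⟩
  · rintro ⟨hxabs, ⟨w, hw, hxw⟩⟩
    refine ⟨(w : ℂˣ) * ofPosReal ℂ Y.region.tip, Y.region.coe_mul_ofPosReal_mem_boundary hw, ?_⟩
    obtain ⟨h1, h2⟩ := unitPart_absHom_polar w Y.region.tip
    apply eq_of_unitPart_eq_of_absHom_eq
    · rw [unitPart_galAct_mul_eq_dirMap, h1, hxw]
    · rw [absHom_galAct, map_mul, h2, htip, hxabs]

/-- In particular the boundary of `Y` is carried into the boundary of `X`.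
[cite: MochizukiFrdII2008, Thm 3.6 (vii) p.37] -/
theorem image_boundary_subset_boundary (φ : Y ⟶ X) (hd : degFr φ = 1)
    (hi : PreFrobenioid.IsIsometry C0.toElem φ) :
    (fun z => D0.galAct (D0.Hom.twists (Base φ)) (scalar φ * z)) '' Y.region.boundary ⊆ X.region.boundary := by
  rw [image_boundary φ hd hi]
  rintro x ⟨h1, h2⟩
  rw [X.region.mem_boundary_iff]
  exact ⟨dirIm_subset_dir φ hd h2, h1⟩

/-- CONSTRUCTOR for linear arrows of `C₀` from direction data: `(b, 1, c) : Y → X` is an arrow as soon as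
`c ∈ L^×`, `|c| · tip(Y) ≤ tip(X)` and `b(u_c · B_Y) ⊆ B_X`. [cite: MochizukiFrdII2008, Ex 3.3 (i) p.27] -/
def linHom (Y X : C0) (b : Y.base ⟶ X.base) (c : ℂˣ) (hc : c ∈ D0.scalars Y.base)
    (hn : ‖(c : ℂ)‖ * Y.tip ≤ X.tip)
    (hdir : ∀ w ∈ Y.region.dir, dirMap (D0.Hom.twists b) (unitPart ℂ c) w ∈ X.region.dir) : Y ⟶ X where
  base := b
  degFr := 1
  scalar := c
  scalar_mem := hc
  mapsTo := by
    rw [PNat.one_coe, pow_one]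
    rintro _ ⟨z, hz, rfl⟩
    refine ⟨D0.galAct (D0.Hom.twists b) (c * z), ⟨?_, ?_⟩, D0.galAct_galAct _ _⟩
    · rw [unitPart_galAct_mul_eq_dirMap]; exact hdir _ hz.1
    · have hz2 : ‖(z : ℂ)‖ ≤ Y.tip := by
        have := hz.2; rwa [← Subtype.coe_le_coe, coe_absHom] at this
      rw [← Subtype.coe_le_coe, coe_absHom, D0.norm_galAct, Units.val_mul, norm_mul]
      calc ‖(c : ℂ)‖ * ‖(z : ℂ)‖ ≤ ‖(c : ℂ)‖ * Y.tip := by gcongr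
        _ ≤ X.tip := hn

/-- `Base` of `linHom`. [cite: MochizukiFrdII2008, Ex 3.3 (i) p.27] -/
@[simp] theorem base_linHom (Y X : C0) (b : Y.base ⟶ X.base) (c : ℂˣ) (hc : c ∈ D0.scalars Y.base)
    (hn : ‖(c : ℂ)‖ * Y.tip ≤ X.tip)
    (hdir : ∀ w ∈ Y.region.dir, dirMap (D0.Hom.twists b) (unitPart ℂ c) w ∈ X.region.dir) :
    Base (linHom Y X b c hc hn hdir) = b := rfl

/-- `deg_Fr(linHom) = 1`. [cite: MochizukiFrdII2008, Ex 3.3 (i) p.27] -/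
@[simp] theorem degFr_linHom (Y X : C0) (b : Y.base ⟶ X.base) (c : ℂˣ) (hc : c ∈ D0.scalars Y.base)
    (hn : ‖(c : ℂ)‖ * Y.tip ≤ X.tip)
    (hdir : ∀ w ∈ Y.region.dir, dirMap (D0.Hom.twists b) (unitPart ℂ c) w ∈ X.region.dir) :
    degFr (linHom Y X b c hc hn hdir) = 1 := rfl

/-- The scalar of `linHom`. [cite: MochizukiFrdII2008, Ex 3.3 (i) p.27] -/
@[simp] theorem scalar_linHom (Y X : C0) (b : Y.base ⟶ X.base) (c : ℂˣ) (hc : c ∈ D0.scalars Y.base)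
    (hn : ‖(c : ℂ)‖ * Y.tip ≤ X.tip)
    (hdir : ∀ w ∈ Y.region.dir, dirMap (D0.Hom.twists b) (unitPart ℂ c) w ∈ X.region.dir) :
    scalar (linHom Y X b c hc hn hdir) = c := rfl

/-- `linHom` is an isometry when `|c| · tip(Y) = tip(X)`. [cite: MochizukiFrdII2008, Ex 3.3 (iii) p.28] -/
theorem isIsometry_linHom (Y X : C0) (b : Y.base ⟶ X.base) (c : ℂˣ) (hc : c ∈ D0.scalars Y.base)
    (hn : ‖(c : ℂ)‖ * Y.tip = X.tip)
    (hdir : ∀ w ∈ Y.region.dir, dirMap (D0.Hom.twists b) (unitPart ℂ c) w ∈ X.region.dir) :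
    PreFrobenioid.IsIsometry C0.toElem (linHom Y X b c hc hn.le hdir) := by
  rw [A0.isIsometry_iff_norm_mul_tip_pow, scalar_linHom, degFr_linHom, PNat.one_coe, pow_one]
  exact hn

/-! ### Cancellation: linear base-isomorphisms of `C₀` are monomorphisms -/

/-- Two arrows of `C₀` with the same composite with a LINEAR arrow whose base is a monomorphism of `D₀`
coincide (Remark 3.3.1-type rigidity). [cite: MochizukiFrdII2008, Rmk 3.3.1 p.29] -/
theorem eq_of_comp_eq_linear {g g' : Y ⟶ Y'} (φ : Y' ⟶ X) (hd : degFr φ = 1) [Mono (Base φ)]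
    (h : g ≫ φ = g' ≫ φ) : g = g' := by
  have hb : Base g = Base g' := by
    rw [← cancel_mono (Base φ)]
    exact congrArg Base h
  have hdeg : degFr g = degFr g' := by
    have := congrArg degFr h
    rw [degFr_comp', degFr_comp', hd, mul_one, mul_one] at this
    exact this
  refine hom_ext hb hdeg ?_
  have hs := congrArg scalar h
  rw [scalar_comp', scalar_comp', hb, hd, PNat.one_coe, pow_one, pow_one] at hs
  exact mul_left_cancel hs

end C0

/-! ### `D₀`: twists of composites ending in an isomorphism -/

/-- For `f : Spec L' → Spec L` and an ISOMORPHISM `g : Spec L → Spec K` of `D₀`, the twist of `f ≫ g` is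
the sum of the twists. [cite: MochizukiFrdII2008, Def 3.1 (i) p.23] -/
theorem D0.twists_comp_of_isIso {K' K K'' : D0} (f : K' ⟶ K) (g : K ⟶ K'') [hg : IsIso g] :
    Hom.twists (f ≫ g) = xor (Hom.twists f) (Hom.twists g) := by
  cases g with
  | idReal =>
    cases f with
    | idReal => rfl
    | toReal => rfl
  | toReal => exact (isEmpty_hom_real_complex.false (inv (Hom.toReal : complex ⟶ real))).elim
  | gal τ =>
    cases f with
    | gal σ => rfl

end ArchFrd

end

end Literature.AlgebraicGeometry.Frobenioids
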